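import Literature.NumberTheory.GaloisRepresentations.GL2ModEightSignData
import HarnessLib

/-!
# A subgroup of `GL₂(ℤ/8ℤ)` onto `GL₂(ℤ/4ℤ)` with a `C₂ × C₂ × C₂` quotient is everything
# (Dokchitser–Dokchitser 2012, proof of Theorem (3)) — PROVED

`Proofs`-style file (theorems only; no definition, no named fact, no instance; D-0014/D-0026).
T. Dokchitser, V. Dokchitser, *Surjectivity of mod `2ⁿ` representations of elliptic curves*, Math.
Z. 272 (2012) 961–964, prove clause (3) of their Theorem (`ρ̄_{E,8}` onto iff `ρ̄_{E,4}` onto and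
`Δ ∉ ±2·ℚ^{×2}`) by: "So `Im ρ̄₈` surjects onto `GL₂(ℤ/4ℤ)` and onto `(ℤ/8ℤ)^×`, and possesses a
`C₂ × C₂ × C₂`-quotient.  A computation shows that the only such subgroup of `GL₂(ℤ/8ℤ)` is the full
group itself."  This file IS that computation, as a kernel-checked argument for the image of an
arbitrary homomorphism `ρ : G →* M₂(ℤ/8ℤ)` (matrices `Matrix (Fin 2) (Fin 2) (ZMod 8)`; the images
are invertible, `det² = 1`, automatically):

* `surjective_of_liftsModFour` — if every invertible `g` is congruent modulo `4` to some `ρ σ`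
  ("onto `GL₂(ℤ/4ℤ)`", spelled `ρ σ = g + 4T`) and the image is not inside the kernel of any of the
  four quadratic characters `χ₂∘det`, `χ₋₂∘det`, `(χ₂∘det)·sgn`, `(χ₋₂∘det)·sgn` (spelled with the
  additive sign data `c2`, `cm1`, `sg` of `GL2ModEightSignData`: some `ρ σ` has `c2 (det) = 1`, etc.),
  then every invertible `g` is some `ρ σ`.  (With "onto `GL₂(ℤ/4)`" the other three nonzero
  characters `χ₋₁∘det`, `sgn`, `(χ₋₁∘det)·sgn` are automatically nontrivial on the image, so the
  hypothesis is exactly "`(χ₂∘det, χ₋₁∘det, sgn)` maps the image ONTO `C₂³`" — the printed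
  "`C₂ × C₂ × C₂`-quotient" `Gal(ℚ(√Δ, √-1, √2)/ℚ)` of `Im ρ̄₈`.)

THE ARGUMENT (replacing "a computation shows"; `H = Im ρ`, `K = 1 + 4M₂(𝔽₂) = ker(GL₂(ℤ/8) → GL₂(ℤ/4))`):
1. (§1) squares of lifts: if `ρσ ≡ 1 + 2M (mod 4)` then `(ρσ)² = (1 + 2M)²` exactly
   (`(1 + 2M + 4T)² = (1+2M)² + 8(…)`), giving `1 + 4E₁₂`, `1 + 4E₂₁`, `1 + 4·1 ∈ H`, hence
   `1 + 4A ∈ H` for every `A` of even trace (`mem_one_add_four_mul`: `K₀ = 1 + 4·sl₂(𝔽₂) ⊆ H`);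
2. (§1) hence EVERY square lies in `H` (`mem_mul_self`): `(s + 4T)² = s²·(1 + 4A)` with
   `tr A = 2 tr(s⁻¹T)` even;
3. (§2) hence the index-`8` subgroup `S⁺ = {det = 1, even modulo 2} = ker phi` lies in `H`
   (`mem_of_phi_eq_zero`): an element `≡ 1 (mod 2)` of determinant `1` factors as
   `(1 0; ca 1)(a 0; 0 a)(1 ba; 0 1)` (`a² = 1`), each factor a square (`v(2y) = v(y)²`, `3·1 = x₃²`,
   `5·1 = x₅²`, `7·1 = w₄²`), and the order-`3` element `w` is `(w²)²`;
4. (§3) the image of `phi = (χ₂∘det, χ₋₁∘det, sgn) : H → (ℤ/2)³` is a subgroup `V` with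
   `V + ⟨(1,0,0)⟩ = (ℤ/2)³` (lifting modulo `4` changes `phi` at most by `phi(1 + 4A) ∈ {0, (1,0,0)}`)
   meeting the complements of the four hyperplanes through which `(1,0,0)` does not pass... i.e. not
   inside `ker λ` for the four functionals `λ` with `λ(1,0,0) = 1`; bookkeeping in `(ℤ/2)³` gives
   `V = (ℤ/2)³` (`phi_surjective`), and `H ⊇ ker phi` then gives `H = GL₂(ℤ/8ℤ)`.
(For the record: step 4 is the statement `Hom(GL₂(ℤ/8ℤ), C₂) = ⟨χ₂∘det, χ₋₁∘det, sgn∘(mod 2)⟩`,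
i.e. `S⁺` is the subgroup generated by the squares.)

## References

* [DokchitserDokchitserMathZ2012] T. Dokchitser, V. Dokchitser, Math. Z. 272 (2012) 961–964,
  proof of the Theorem, clause (3). [corpus:paper:arxiv-1104.5031 p0001 L58–L98]
* [SerreAbelianLAdic1968] J.-P. Serre, *Abelian `ℓ`-adic representations and elliptic curves*,
  Benjamin (1968), IV.3.4, Lemma 3 and exercises (subgroups of `GL₂(ℤ/ℓⁿℤ)`; the case `ℓ = 2`).
-/

set_option autoImplicit false

namespace Literature.NumberTheory.GaloisRepresentations.GL2Mod8

open Matrix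

variable {G : Type*} [Group G] (ρ : G →* M8)

/-! ### §0. The image consists of invertible matrices -/

/-- `det (ρ σ)` is a unit of `ℤ/8` (so `det² = 1`).
[cite: DokchitserDokchitserMathZ2012, proof of Theorem (3) (bookkeeping for the computation in GL₂(ℤ/8ℤ))] -/
theorem det_map_mul_self (σ : G) : (ρ σ).det * (ρ σ).det = 1 := by
  have h : (ρ σ).det * (ρ σ⁻¹).det = 1 := by
    rw [← Matrix.det_mul, ← map_mul, mul_inv_cancel, map_one, Matrix.det_one]
  exact mul_self_of_mul_eq_one h

/-- `phi ∘ ρ` is a homomorphism.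
[cite: DokchitserDokchitserMathZ2012, proof of Theorem (3) (bookkeeping for the computation in GL₂(ℤ/8ℤ))] -/
theorem phi_map_mul (σ τ : G) : phi (ρ (σ * τ)) = phi (ρ σ) + phi (ρ τ) := by
  rw [map_mul, phi_mul (det_map_mul_self ρ σ) (det_map_mul_self ρ τ)]

variable (hL : ∀ g : M8, g.det * g.det = 1 → ∃ σ : G, ∃ T : M8, ρ σ = g + 4 * T)

/-! ### §1. Squares of lifts: `1 + 4·sl₂(𝔽₂) ⊆ H`, then every square lies in `H` -/

/-- `(1 + 2M + 4T)² = (1 + 2M)²` in `M₂(ℤ/8)`.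
[cite: DokchitserDokchitserMathZ2012, proof of Theorem (3) (bookkeeping for the computation in GL₂(ℤ/8ℤ))] -/
theorem sq_one_add_two_mul_add_four_mul (M T : M8) :
    (1 + 2 * M + 4 * T) * (1 + 2 * M + 4 * T) = (1 + 2 * M) * (1 + 2 * M) := by
  have h : (1 + 2 * M + 4 * T) * (1 + 2 * M + 4 * T) =
      (1 + 2 * M) * (1 + 2 * M) + 8 * (T + M * T + T * M + 2 * (T * T)) := by
    noncomm_ring
  rw [h, eight_eq_zero, zero_mul, add_zero]

include hL in
/-- The square of `1 + 2M` lies in the image whenever `1 + 2M` is invertible (square any lift).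
[cite: DokchitserDokchitserMathZ2012, proof of Theorem (3) (the computation in GL₂(ℤ/8ℤ))] -/
theorem mem_sq_one_add_two_mul (M : M8) (hM : (1 + 2 * M).det * (1 + 2 * M).det = 1) :
    ∃ σ : G, ρ σ = (1 + 2 * M) * (1 + 2 * M) := by
  obtain ⟨σ, T, hσ⟩ := hL _ hM
  exact ⟨σ * σ, by rw [map_mul, hσ, sq_one_add_two_mul_add_four_mul]⟩

include hL in
/-- `1 + 4E₁₂ ∈ H`.
[cite: DokchitserDokchitserMathZ2012, proof of Theorem (3) (bookkeeping for the computation in GL₂(ℤ/8ℤ))] -/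
theorem mem_one_add_four_E12 : ∃ σ : G, ρ σ = !![1, 4; 0, 1] := by
  obtain ⟨σ, h⟩ := mem_sq_one_add_two_mul ρ hL !![0, 1; 0, 0] (by decide)
  exact ⟨σ, by rw [h]; decide⟩

include hL in
/-- `1 + 4E₂₁ ∈ H`.
[cite: DokchitserDokchitserMathZ2012, proof of Theorem (3) (bookkeeping for the computation in GL₂(ℤ/8ℤ))] -/
theorem mem_one_add_four_E21 : ∃ σ : G, ρ σ = !![1, 0; 4, 1] := by
  obtain ⟨σ, h⟩ := mem_sq_one_add_two_mul ρ hL !![0, 0; 1, 0] (by decide)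
  exact ⟨σ, by rw [h]; decide⟩

include hL in
/-- `1 + 4·1 = 5·1 ∈ H` (the square of `1 + 2(1 1; 1 0)`).
[cite: DokchitserDokchitserMathZ2012, proof of Theorem (3) (bookkeeping for the computation in GL₂(ℤ/8ℤ))] -/
theorem mem_five : ∃ σ : G, ρ σ = !![5, 0; 0, 5] := by
  obtain ⟨σ, h⟩ := mem_sq_one_add_two_mul ρ hL !![1, 1; 1, 0] (by decide)
  exact ⟨σ, by rw [h]; decide⟩

/-- The factorisation `1 + 4A = (1+4a 0; 0 1+4a)(1 4b; 0 1)(1 0; 4c 1)` for `A = (a b; c d)` with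
`4a = 4d`.
[cite: DokchitserDokchitserMathZ2012, proof of Theorem (3) (bookkeeping for the computation in GL₂(ℤ/8ℤ))] -/
theorem one_add_four_mul_eq (A : M8) (hA : 4 * A 0 0 = 4 * A 1 1) :
    1 + 4 * A = !![1 + 4 * A 0 0, 0; 0, 1 + 4 * A 0 0] * !![1, 4 * A 0 1; 0, 1] *
      !![1, 0; 4 * A 1 0, 1] := by
  have h8 : (8 : ZMod 8) = 0 := by decide
  ext i j
  fin_cases i <;> fin_cases j <;>
    simp [Matrix.mul_apply, Fin.sum_univ_two, Matrix.ofNat_apply]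
  · linear_combination (2 * A 0 1 * A 1 0 + 8 * A 0 0 * A 0 1 * A 1 0) * h8
  · linear_combination (-2 * A 0 1 * A 0 0) * h8
  · linear_combination (-2 * A 1 0 * A 0 0) * h8
  · linear_combination (-1 : ZMod 8) * hA

include hL in
/-- **`K₀ = 1 + 4·sl₂(𝔽₂) ⊆ H`**: `1 + 4A ∈ H` for every `A` with `4·tr A = 0` (i.e. `4a = 4d`).
[cite: DokchitserDokchitserMathZ2012, proof of Theorem (3) (the computation in GL₂(ℤ/8ℤ))] -/
theorem mem_one_add_four_mul (A : M8) (hA : 4 * A 0 0 = 4 * A 1 1) : ∃ σ : G, ρ σ = 1 + 4 * A := by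
  have hD : ∃ σ : G, ρ σ = !![1 + 4 * A 0 0, 0; 0, 1 + 4 * A 0 0] := by
    rcases four_mul_eq_zero_or (A 0 0) with h | h <;> rw [h]
    · exact ⟨1, by rw [map_one]; decide⟩
    · obtain ⟨σ, hσ⟩ := mem_five ρ hL
      exact ⟨σ, by rw [hσ]; decide⟩
  have hU : ∃ σ : G, ρ σ = !![1, 4 * A 0 1; 0, 1] := by
    rcases four_mul_eq_zero_or (A 0 1) with h | h <;> rw [h]
    · exact ⟨1, by rw [map_one]; decide⟩
    · exact mem_one_add_four_E12 ρ hL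
  have hV : ∃ σ : G, ρ σ = !![1, 0; 4 * A 1 0, 1] := by
    rcases four_mul_eq_zero_or (A 1 0) with h | h <;> rw [h]
    · exact ⟨1, by rw [map_one]; decide⟩
    · exact mem_one_add_four_E21 ρ hL
  obtain ⟨σ₁, h₁⟩ := hD
  obtain ⟨σ₂, h₂⟩ := hU
  obtain ⟨σ₃, h₃⟩ := hV
  exact ⟨σ₁ * σ₂ * σ₃, by rw [map_mul, map_mul, h₁, h₂, h₃, one_add_four_mul_eq A hA]⟩

include hL in
/-- **Every square lies in `H`**: `(s + 4T)² = s² · (1 + 4A)` with `A = s⁻¹T + s⁻²Ts` of even trace.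
[cite: DokchitserDokchitserMathZ2012, proof of Theorem (3) (the computation in GL₂(ℤ/8ℤ))] -/
theorem mem_mul_self (s : M8) (hs : s.det * s.det = 1) : ∃ σ : G, ρ σ = s * s := by
  obtain ⟨σ, T, hσ⟩ := hL s hs
  have h16 : (16 : M8) = 0 := by
    rw [show (16 : M8) = 8 * 2 by norm_num, eight_eq_zero, zero_mul]
  -- the correcting factor
  have e1 : s * s * (inv' s * T) = s * T := by
    rw [show s * s * (inv' s * T) = s * ((s * inv' s) * T) by noncomm_ring, mul_inv' hs, one_mul]
  have e2 : s * s * (inv' s * inv' s * T * s) = T * s := by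
    rw [show s * s * (inv' s * inv' s * T * s) = s * ((s * inv' s) * (inv' s * (T * s))) by
      noncomm_ring, mul_inv' hs, one_mul, ← mul_assoc, mul_inv' hs, one_mul]
  have key : (s + 4 * T) * (s + 4 * T) = s * s * (1 + 4 * (inv' s * T + inv' s * inv' s * T * s)) := by
    have h1 : (s + 4 * T) * (s + 4 * T) = s * s + 4 * (s * T + T * s) + 16 * (T * T) := by
      noncomm_ring
    have h2 : s * s * (1 + 4 * (inv' s * T + inv' s * inv' s * T * s)) =
        s * s + 4 * (s * s * (inv' s * T) + s * s * (inv' s * inv' s * T * s)) := by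
      noncomm_ring
    rw [h1, h2, e1, e2, h16, zero_mul, add_zero]
  -- its trace is even
  have htr : (inv' s * inv' s * T * s).trace = (inv' s * T).trace := by
    rw [Matrix.trace_mul_comm, ← mul_assoc, ← mul_assoc, mul_inv' hs, one_mul]
  have hsum : (inv' s * T + inv' s * inv' s * T * s) 0 0 + (inv' s * T + inv' s * inv' s * T * s) 1 1 =
      2 * ((inv' s * T) 0 0 + (inv' s * T) 1 1) := by
    have h := congrArg Matrix.trace (rfl : inv' s * T + inv' s * inv' s * T * s = _)
    rw [← Matrix.trace_fin_two, Matrix.trace_add, htr, ← Matrix.trace_fin_two, two_mul]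
  obtain ⟨τ, hτ⟩ := mem_one_add_four_mul ρ hL _ (four_mul_eq_of_add_eq_two_mul hsum)
  refine ⟨σ * σ * τ, ?_⟩
  rw [map_mul, map_mul, hσ, hτ, key, mul_assoc (s * s), one_add_four_mul_sq, mul_one]

/-! ### §2. The index-`8` subgroup `ker phi = {det = 1, even mod 2}` lies in `H` -/

/-- The factorisation of a matrix `≡ 1 (mod 2)` of determinant `1`:
`(a b; c d) = (1 0; ca 1)(a 0; 0 a)(1 ba; 0 1)` when `a² = 1`, `ad - bc = 1`.
[cite: DokchitserDokchitserMathZ2012, proof of Theorem (3) (bookkeeping for the computation in GL₂(ℤ/8ℤ))] -/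
theorem eq_lower_mul_diag_mul_upper (a b c d : ZMod 8) (ha : a * a = 1) (hdet : a * d - b * c = 1) :
    (!![a, b; c, d] : M8) = !![1, 0; c * a, 1] * !![a, 0; 0, a] * !![1, b * a; 0, 1] := by
  ext i j
  fin_cases i <;> fin_cases j <;> simp [Matrix.mul_apply, Fin.sum_univ_two]
  · linear_combination (-b) * ha
  · linear_combination (-c) * ha
  · linear_combination (-d - a * b * c) * ha + a * hdet

include hL in
/-- A lower unipotent `(1 0; z 1)` with `z` even lies in `H` (`= (1 0; y 1)²`, `z = 2y`).
[cite: DokchitserDokchitserMathZ2012, proof of Theorem (3) (bookkeeping for the computation in GL₂(ℤ/8ℤ))] -/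
theorem mem_lower {z : ZMod 8} (hz : red z = 0) : ∃ σ : G, ρ σ = !![1, 0; z, 1] := by
  obtain ⟨y, rfl⟩ := exists_eq_two_mul hz
  obtain ⟨σ, hσ⟩ := mem_mul_self ρ hL !![1, 0; y, 1] (by simp [Matrix.det_fin_two])
  exact ⟨σ, by rw [hσ]; simp; ring⟩

include hL in
/-- An upper unipotent `(1 z; 0 1)` with `z` even lies in `H`.
[cite: DokchitserDokchitserMathZ2012, proof of Theorem (3) (bookkeeping for the computation in GL₂(ℤ/8ℤ))] -/
theorem mem_upper {z : ZMod 8} (hz : red z = 0) : ∃ σ : G, ρ σ = !![1, z; 0, 1] := by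
  obtain ⟨y, rfl⟩ := exists_eq_two_mul hz
  obtain ⟨σ, hσ⟩ := mem_mul_self ρ hL !![1, y; 0, 1] (by simp [Matrix.det_fin_two])
  exact ⟨σ, by rw [hσ]; simp; ring⟩

include hL in
/-- A scalar `a·1` with `a` odd lies in `H`: `1`, `3·1 = (1 1; 2 7)²`, `5·1 = (0 1; 5 0)²`,
`7·1 = (0 7; 1 0)²`.
[cite: DokchitserDokchitserMathZ2012, proof of Theorem (3) (bookkeeping for the computation in GL₂(ℤ/8ℤ))] -/
theorem mem_scalar {a : ZMod 8} (ha : red a = 1) : ∃ σ : G, ρ σ = !![a, 0; 0, a] := by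
  rcases eq_of_red_eq_one a ha with rfl | rfl | rfl | rfl
  · exact ⟨1, by rw [map_one]; decide⟩
  · obtain ⟨σ, hσ⟩ := mem_mul_self ρ hL !![1, 1; 2, 7] (by decide)
    exact ⟨σ, by rw [hσ]; decide⟩
  · obtain ⟨σ, hσ⟩ := mem_mul_self ρ hL !![0, 1; 5, 0] (by decide)
    exact ⟨σ, by rw [hσ]; decide⟩
  · obtain ⟨σ, hσ⟩ := mem_mul_self ρ hL !![0, 7; 1, 0] (by decide)
    exact ⟨σ, by rw [hσ]; decide⟩

include hL in
/-- **`Γ(2) ∩ SL₂ ⊆ H`**: a matrix of determinant `1` which is `≡ 1 (mod 2)` lies in `H`.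
[cite: DokchitserDokchitserMathZ2012, proof of Theorem (3) (the computation in GL₂(ℤ/8ℤ))] -/
theorem mem_of_det_eq_one_of_par (t : M8) (ht : t.det = 1) (hp : par t = (1, 0, 0, 1)) :
    ∃ σ : G, ρ σ = t := by
  simp only [par, Prod.mk.injEq] at hp
  obtain ⟨ha, hb, hc, -⟩ := hp
  have haa : t 0 0 * t 0 0 = 1 := (mul_self_eq_one_iff _).mpr ha
  have hdet : t 0 0 * t 1 1 - t 0 1 * t 1 0 = 1 := by rw [← Matrix.det_fin_two]; exact ht
  obtain ⟨σ₁, h₁⟩ := mem_lower ρ hL (z := t 1 0 * t 0 0) (by rw [map_mul, hc, zero_mul])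
  obtain ⟨σ₂, h₂⟩ := mem_scalar ρ hL ha
  obtain ⟨σ₃, h₃⟩ := mem_upper ρ hL (z := t 0 1 * t 0 0) (by rw [map_mul, hb, zero_mul])
  refine ⟨σ₁ * σ₂ * σ₃, ?_⟩
  rw [map_mul, map_mul, h₁, h₂, h₃, Matrix.eta_fin_two t]
  exact (eq_lower_mul_diag_mul_upper _ _ _ _ haa hdet).symm

/-- The order-`3` element `w = (0 7; 1 7)` (`≡ (0 1; 1 1) (mod 2)`): `w³ = 1`, `det w = 1`,
`par w = (0,1,1,1)`, `par w² = (1,1,1,0)`.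
[cite: DokchitserDokchitserMathZ2012, proof of Theorem (3) (bookkeeping for the computation in GL₂(ℤ/8ℤ))] -/
theorem w_facts : (!![0, 7; 1, 7] : M8) * !![0, 7; 1, 7] * !![0, 7; 1, 7] = 1 ∧
    (!![0, 7; 1, 7] : M8).det = 1 ∧ par !![0, 7; 1, 7] = (0, 1, 1, 1) ∧
    par ((!![0, 7; 1, 7] : M8) * !![0, 7; 1, 7]) = (1, 1, 1, 0) := by
  decide

include hL in
/-- `w ∈ H` (`w = (w²)²`).
[cite: DokchitserDokchitserMathZ2012, proof of Theorem (3) (bookkeeping for the computation in GL₂(ℤ/8ℤ))] -/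
theorem mem_w : ∃ σ : G, ρ σ = !![0, 7; 1, 7] := by
  obtain ⟨σ, hσ⟩ := mem_mul_self ρ hL ((!![0, 7; 1, 7] : M8) * !![0, 7; 1, 7]) (by decide)
  exact ⟨σ, by rw [hσ]; decide⟩

include hL in
/-- **`ker phi ⊆ H`**: an invertible matrix with trivial sign datum (determinant `1`, reduction in
`A₃ ⊂ S₃ ≅ GL₂(𝔽₂)`) lies in `H`.
[cite: DokchitserDokchitserMathZ2012, proof of Theorem (3) (the computation in GL₂(ℤ/8ℤ))] -/
theorem mem_of_phi_eq_zero (t : M8) (ht : t.det * t.det = 1) (h0 : phi t = 0) : ∃ σ : G, ρ σ = t := by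
  simp only [phi, Prod.mk_eq_zero] at h0
  obtain ⟨h2, hm1, hsg⟩ := h0
  have hdet : t.det = 1 := eq_one_of_c2_of_cm1 ht h2 hm1
  have hpd : P4.det (par t) = 1 := by rw [← red_det, hdet, map_one]
  obtain ⟨w3, wdet, wpar, w2par⟩ := w_facts
  rcases eps_eq_zero_cases (par t) hpd hsg with hp | hp | hp
  · exact mem_of_det_eq_one_of_par ρ hL t hdet hp
  · -- `t ≡ w (mod 2)`: `t w² ≡ 1`
    obtain ⟨σ₁, h₁⟩ := mem_of_det_eq_one_of_par ρ hL (t * !![0, 7; 1, 7] * !![0, 7; 1, 7])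
      (by rw [Matrix.det_mul, Matrix.det_mul, hdet, wdet, one_mul, one_mul])
      (by rw [par_mul, par_mul, hp, wpar]; decide)
    obtain ⟨σ₂, h₂⟩ := mem_w ρ hL
    refine ⟨σ₁ * σ₂, ?_⟩
    rw [map_mul, h₁, h₂, mul_assoc t, mul_assoc t, w3, mul_one]
  · -- `t ≡ w² (mod 2)`: `t w ≡ 1`
    obtain ⟨σ₁, h₁⟩ := mem_of_det_eq_one_of_par ρ hL (t * !![0, 7; 1, 7])
      (by rw [Matrix.det_mul, hdet, wdet, one_mul])
      (by rw [par_mul, hp, wpar]; decide)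
    obtain ⟨σ₂, h₂⟩ := mem_mul_self ρ hL (!![0, 7; 1, 7] : M8) (by rw [wdet, one_mul])
    refine ⟨σ₁ * σ₂, ?_⟩
    rw [map_mul, h₁, h₂, mul_assoc t, ← mul_assoc (!![0, 7; 1, 7] : M8), w3, mul_one]

/-! ### §3. The sign data of `H` exhaust `(ℤ/2)³`; conclusion -/

include hL in
/-- Lifting modulo `4` realises every sign datum up to `(1,0,0)`:
`phi(ρσ) ∈ {v, v + (1,0,0)}` for a lift `ρσ ≡ rep v (mod 4)`.
[cite: DokchitserDokchitserMathZ2012, proof of Theorem (3) (bookkeeping for the computation in GL₂(ℤ/8ℤ))] -/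
theorem exists_phi_eq_or (v : V3) :
    (∃ σ : G, phi (ρ σ) = v) ∨ ∃ σ : G, phi (ρ σ) = v + (1, 0, 0) := by
  obtain ⟨σ, T, hσ⟩ := hL (rep v) (det_rep v)
  rw [add_four_mul_eq (det_rep v)] at hσ
  have hphi : phi (ρ σ) = v + phi (1 + 4 * (inv' (rep v) * T)) := by
    rw [hσ, phi_mul (det_rep v) (det_one_add_four_mul _), phi_rep]
  rcases phi_one_add_four_mul (inv' (rep v) * T) with h | h
  · exact Or.inl ⟨σ, by rw [hphi, h, add_zero]⟩
  · exact Or.inr ⟨σ, by rw [hphi, h]⟩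

/-- Additivity of realised sign data.
[cite: DokchitserDokchitserMathZ2012, proof of Theorem (3) (bookkeeping for the computation in GL₂(ℤ/8ℤ))] -/
theorem exists_phi_eq_add {v v' : V3} (hv : ∃ σ : G, phi (ρ σ) = v) (hv' : ∃ σ : G, phi (ρ σ) = v') :
    ∃ σ : G, phi (ρ σ) = v + v' := by
  obtain ⟨σ, rfl⟩ := hv
  obtain ⟨σ', rfl⟩ := hv'
  exact ⟨σ * σ', phi_map_mul ρ σ σ'⟩

/-- Bookkeeping in `(ℤ/2)³`: the vectors with `x = 1`, as `(1,0,0) = v + (known vectors)`. [folklore] -/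
private theorem V3.cases_x : ∀ v : V3, v.1 = 1 → (1, 0, 0) = v ∨ (1, 0, 0) = v + (0, 1, 0) ∨
    (1, 0, 0) = v + (0, 0, 1) ∨ (1, 0, 0) = v + (0, 1, 0) + (0, 0, 1) := by decide

/-- Bookkeeping in `(ℤ/2)³`: the vectors with `x + z = 1`. [folklore] -/
private theorem V3.cases_xz : ∀ v : V3, v.1 + v.2.2 = 1 → (1, 0, 0) = v ∨ (1, 0, 0) = v + (0, 1, 0) ∨
    (1, 0, 0) = v + (1, 0, 1) ∨ (1, 0, 0) = v + (0, 1, 0) + (1, 0, 1) := by decide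

/-- Bookkeeping in `(ℤ/2)³`: the vectors with `x + y = 1`. [folklore] -/
private theorem V3.cases_xy : ∀ v : V3, v.1 + v.2.1 = 1 → (1, 0, 0) = v ∨ (1, 0, 0) = v + (0, 0, 1) ∨
    (1, 0, 0) = v + (1, 1, 0) ∨ (1, 0, 0) = v + (0, 0, 1) + (1, 1, 0) := by decide

/-- Bookkeeping in `(ℤ/2)³`: the vectors with `x + y + z = 1`. [folklore] -/
private theorem V3.cases_xyz : ∀ v : V3, v.1 + v.2.1 + v.2.2 = 1 → (1, 0, 0) = v ∨
    (1, 0, 0) = v + (1, 1, 0) ∨ (1, 0, 0) = v + (1, 0, 1) ∨ (1, 0, 0) = v + (1, 1, 0) + (1, 0, 1) := by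
  decide

include hL in
/-- **The sign data of `H` exhaust `(ℤ/2)³`** (the "`C₂ × C₂ × C₂`-quotient" together with "onto
`GL₂(ℤ/4ℤ)`"): given elements of `H` outside the kernels of `χ₂∘det`, `χ₋₂∘det`, `(χ₂∘det)·sgn`,
`(χ₋₂∘det)·sgn`, every sign datum is realised.
[cite: DokchitserDokchitserMathZ2012, proof of Theorem (3) (Im ρ̄₈ ↠ GL₂(ℤ/4ℤ) and ↠ (ℤ/8ℤ)^× with a C₂³-quotient)] -/
theorem phi_surjective (h₁ : ∃ σ : G, c2 (ρ σ).det = 1)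
    (h₂ : ∃ σ : G, c2 (ρ σ).det + cm1 (ρ σ).det = 1)
    (h₃ : ∃ σ : G, c2 (ρ σ).det + sg (ρ σ) = 1)
    (h₄ : ∃ σ : G, c2 (ρ σ).det + cm1 (ρ σ).det + sg (ρ σ) = 1) (v : V3) :
    ∃ σ : G, phi (ρ σ) = v := by
  -- it suffices to realise `(1,0,0)`
  suffices he : ∃ σ : G, phi (ρ σ) = (1, 0, 0) by
    rcases exists_phi_eq_or ρ hL v with h | h
    · exact h
    · have h' := exists_phi_eq_add ρ h he
      rwa [add_assoc, show ((1, 0, 0) : V3) + (1, 0, 0) = 0 by decide, add_zero] at h'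
  obtain ⟨σ₁, e₁⟩ := h₁
  obtain ⟨σ₂, e₂⟩ := h₂
  obtain ⟨σ₃, e₃⟩ := h₃
  obtain ⟨σ₄, e₄⟩ := h₄
  have w₁ : ∃ σ : G, phi (ρ σ) = phi (ρ σ₁) := ⟨σ₁, rfl⟩
  have w₂ : ∃ σ : G, phi (ρ σ) = phi (ρ σ₂) := ⟨σ₂, rfl⟩
  have w₃ : ∃ σ : G, phi (ρ σ) = phi (ρ σ₃) := ⟨σ₃, rfl⟩
  have w₄ : ∃ σ : G, phi (ρ σ) = phi (ρ σ₄) := ⟨σ₄, rfl⟩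
  have hA := exists_phi_eq_or ρ hL (0, 1, 0)
  have hB := exists_phi_eq_or ρ hL (0, 0, 1)
  rw [show ((0, 1, 0) : V3) + (1, 0, 0) = (1, 1, 0) by decide] at hA
  rw [show ((0, 0, 1) : V3) + (1, 0, 0) = (1, 0, 1) by decide] at hB
  rcases hA with hA | hA <;> rcases hB with hB | hB
  · rcases V3.cases_x (phi (ρ σ₁)) e₁ with h | h | h | h <;> rw [h]
    exacts [w₁, exists_phi_eq_add ρ w₁ hA, exists_phi_eq_add ρ w₁ hB,
      exists_phi_eq_add ρ (exists_phi_eq_add ρ w₁ hA) hB]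
  · rcases V3.cases_xz (phi (ρ σ₃)) e₃ with h | h | h | h <;> rw [h]
    exacts [w₃, exists_phi_eq_add ρ w₃ hA, exists_phi_eq_add ρ w₃ hB,
      exists_phi_eq_add ρ (exists_phi_eq_add ρ w₃ hA) hB]
  · rcases V3.cases_xy (phi (ρ σ₂)) e₂ with h | h | h | h <;> rw [h]
    exacts [w₂, exists_phi_eq_add ρ w₂ hB, exists_phi_eq_add ρ w₂ hA,
      exists_phi_eq_add ρ (exists_phi_eq_add ρ w₂ hB) hA]
  · rcases V3.cases_xyz (phi (ρ σ₄)) e₄ with h | h | h | h <;> rw [h]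
    exacts [w₄, exists_phi_eq_add ρ w₄ hA, exists_phi_eq_add ρ w₄ hB,
      exists_phi_eq_add ρ (exists_phi_eq_add ρ w₄ hA) hB]

include hL in
/-- **Dokchitser–Dokchitser's computation in `GL₂(ℤ/8ℤ)`.** Let `ρ : G → M₂(ℤ/8ℤ)` be a
homomorphism such that every invertible matrix is congruent modulo `4` to some `ρ σ` (the image
maps onto `GL₂(ℤ/4ℤ)`) and such that the image is not contained in the kernel of any of the
characters `χ₂∘det`, `χ₋₂∘det`, `(χ₂∘det)·sgn`, `(χ₋₂∘det)·sgn` (with "onto `GL₂(ℤ/4ℤ)`": the image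
has the full `C₂ × C₂ × C₂` of sign data as a quotient).  Then `ρ` is onto `GL₂(ℤ/8ℤ)`: "the only
such subgroup of `GL₂(ℤ/8ℤ)` is the full group itself".
[cite: DokchitserDokchitserMathZ2012, proof of Theorem (3) (the only such subgroup of GL₂(ℤ/8ℤ) is the full group)] -/
theorem surjective_of_liftsModFour (h₁ : ∃ σ : G, c2 (ρ σ).det = 1)
    (h₂ : ∃ σ : G, c2 (ρ σ).det + cm1 (ρ σ).det = 1)
    (h₃ : ∃ σ : G, c2 (ρ σ).det + sg (ρ σ) = 1)
    (h₄ : ∃ σ : G, c2 (ρ σ).det + cm1 (ρ σ).det + sg (ρ σ) = 1)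
    (g : M8) (hg : g.det * g.det = 1) : ∃ σ : G, ρ σ = g := by
  obtain ⟨σ, hσ⟩ := phi_surjective ρ hL h₁ h₂ h₃ h₄ (phi g)
  have hι := det_inv'_mul_self (det_map_mul_self ρ σ)
  have ht : phi (g * inv' (ρ σ)) = 0 := by
    rw [phi_mul hg hι, phi_inv' (det_map_mul_self ρ σ), hσ, V3.add_self]
  have hdt : (g * inv' (ρ σ)).det * (g * inv' (ρ σ)).det = 1 := by
    rw [Matrix.det_mul, mul_mul_mul_comm, hg, hι, one_mul]
  obtain ⟨τ, hτ⟩ := mem_of_phi_eq_zero ρ hL _ hdt ht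
  exact ⟨τ * σ, by rw [map_mul, hτ, mul_assoc, inv'_mul (det_map_mul_self ρ σ), mul_one]⟩

end Literature.NumberTheory.GaloisRepresentations.GL2Mod8
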